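import Literature.LinearAlgebra.Matrix.QuadraticIntegerMatrixClassesHigherRank
import HarnessLib

/-!
# Integer matrices with `B² = B + m·1` (`d = 1 + 4m ≡ 1 (mod 4)`): exactly `h(ℚ(√d))` classes under `GL(ℤ)` in every
# size `2(s+1)` — `B² = B − 2` (one class), `B² = B − 4` (two), `B² = B − 6` (EXACTLY THREE), `B² = B − 41` (one)

[topic LinearAlgebra/Matrix] Lane `lit-hodgefound` (Track 2 foundations library), seat p15 generation 39, row g39-#10 —
the `d_K ≡ 1 (mod 4)` sequel of g39-#9 `QuadraticIntegerMatrixClassesHigherRank` (there `θ² = m`, `d_K = 4m`).  For a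
squarefree `d = 1 + 4m < 0` the ring of integers of `K = ℚ(√d)` is `ℤ[τ]`, `τ = (1 + √d)/2`, `τ² = τ + m`; Reiner's
Remark (Steinitz over the Dedekind ring `ℤ[τ]`, g39-#9's `natCard_quot_conj_aeval_eq_zero_eq_card_classGroup`) counts
the integer matrices `B` of size `2(s+1)` with `B² = B + m·1` modulo `GL(ℤ)`: exactly `h_K = h(d)` classes, the
class number being the tree's kernel-decided `BinQF.classNumber d` (`ClassNumberValues.classNumber_eq_of_discr_eq`).
THEOREMS ONLY (no definition, no instance, no named fact; D-0026 net Literature debt `0`; no `sorry`).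

## Sources, VERBATIM

* I. Reiner, *Integral representations of cyclic groups of prime order*, Proc. Amer. Math. Soc. 8 (1957) 142–146
  [Reiner1957], §1 Lemma 2 (Steinitz, Chevalley: «The `𝔬`-rank `n` and the ideal class of `𝔄_1⋯𝔄_n` are the only
  invariants») and the Remark following it («Let `f(x) ∈ Z[x]` be a monic irreducible polynomial, and let `f(θ) = 0`.
  Assume that `Z[θ]` coincides with the ring of all algebraic integers in `Q(θ)`. Then … every integral matrix `X`
  for which `f(X) = 0`, is integrally decomposable into a direct sum of irreducible matrices satisfying `f(X) = 0`.»)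
  — here `f = x² − x − m`.
* D. A. Marcus, *Number Fields* [Marcus2018], Ch. 2 Thm. 1 (`𝒪 = ℤ[(1 + √d)/2]`, `disc = d` for squarefree
  `d ≡ 1 (mod 4)`) — the tree's `DiscriminantOfSqrt.discr_eq_of_sq_eq_intCast` and `TauData`.
* D. A. Cox, *Primes of the form x² + ny²* [Cox2013], §2.A Thm. 2.13 (`h(D)` = number of reduced forms) and §7.B
  Thm. 7.7 (ii) (`h(d_K) = #C(𝒪_K)`); the values `h(−7) = 1`, `h(−15) = 2`, `h(−23) = 3`, `h(−163) = 1` (§2.A and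
  Thm. 7.30 (i), the class number one discriminants) — kernel-decided here / the tree's `classNumber_neg23`.

## What is formalised

* §1 `natCard_quot_conj_sq_eq_self_add_smul_one_eq_classNumber`: `K` quadratic, `θ ∈ K` with `θ² = 1 + 4m`
  (`1 + 4m < 0` squarefree): in every size `2(s+1)` the `B ∈ M(ℤ)` with `B² = B + m·1` form exactly `h_K` classes.
* §2 instances (every size `2(s+1)`): **`natCard_quot_conj_sq_eq_self_sub_two`** (`B² = B − 2·1`, `d = −7`: `= 1`)
  with `exists_isUnit_conj_of_sq_eq_self_sub_two`; **`natCard_quot_conj_sq_eq_self_sub_four`** (`d = −15`: `= 2`);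
  **`natCard_quot_conj_sq_eq_self_sub_six`** (`d = −23`: `= 3`) with **`exists_triple_sq_eq_self_sub_six`** (three
  pairwise non-conjugate solutions to one of which every solution is conjugate); **`natCard_quot_conj_sq_eq_self_sub_fortyOne`**
  (`d = −163`, Heegner: `= 1`) with `exists_isUnit_conj_of_sq_eq_self_sub_fortyOne`.

## References
* [Reiner1957] I. Reiner, Proc. Amer. Math. Soc. 8 (1957) 142–146, §1. [cite: Reiner1957, §1 Lemma 2 and Remark]
* [Marcus2018] D. A. Marcus, *Number Fields*, 2nd ed., Ch. 2 Thm. 1.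
* [Cox2013] D. A. Cox, *Primes of the form x² + ny²*, 2nd ed., §2.A Thm. 2.13, §7.B Thm. 7.7, Thm. 7.30.
-/

noncomputable section

open scoped Classical nonZeroDivisors NumberField
open Polynomial Module Submodule

namespace Literature.LinearAlgebra.Matrix.QuadraticIntegerMatrixClassesOddDiscriminant

open Literature.LinearAlgebra.Matrix.QuadraticIntegerMatrixClassesHigherRank
open Literature.NumberTheory.QuadraticFields.Quadratic
open Literature.NumberTheory.QuadraticFields.ClassNumberValues (classNumber_eq_of_discr_eq classNumber_neg23)

/-! ## §0 Plumbing -/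

/-- From `Nat.card (Quot r) = 1` for an equivalence relation `r`: any two elements are related. [folklore] (private
helper, as in g39-#3) -/
private theorem rel_of_natCard_quot_eq_one {α : Type*} {r : α → α → Prop} (hr : Equivalence r)
    (h : Nat.card (Quot r) = 1) (a b : α) : r a b := by
  have hsub : Subsingleton (Quot r) := (Nat.card_eq_one_iff_unique.mp h).1
  exact hr.eqvGen_iff.mp (Quot.eqvGen_exact (Subsingleton.elim (Quot.mk r a) (Quot.mk r b)))

/-- From `Nat.card (Quot r) = n` for an equivalence relation `r`: `n` pairwise unrelated elements to one of which
every element is related. [folklore] (proved here; private helper) -/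
private theorem exists_fun_of_natCard_quot_eq {α : Type*} {r : α → α → Prop} (hr : Equivalence r) {n : ℕ}
    (hn : 0 < n) (h : Nat.card (Quot r) = n) :
    ∃ f : Fin n → α, (Pairwise fun i j => ¬ r (f i) (f j)) ∧ ∀ c : α, ∃ i, r c (f i) := by
  let e : Quot r ≃ Fin n := Nat.equivFinOfCardPos (by omega) |>.trans (finCongr h)
  choose f hf using fun i : Fin n => Quot.exists_rep (e.symm i)
  refine ⟨f, fun i j hij hrel => hij (e.symm.injective ?_), fun c => ⟨e (Quot.mk r c), ?_⟩⟩
  · rw [← hf i, ← hf j]; exact Quot.sound hrel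
  · have h1 : Quot.mk r c = Quot.mk r (f (e (Quot.mk r c))) := by rw [hf, Equiv.symm_apply_apply]
    exact hr.eqvGen_iff.mp (Quot.eqvGen_exact h1)

/-- The relation `∃ Q ∈ GL_N(ℤ), QB = B′Q` pulled back to a subtype of `M_N(ℤ)` is an equivalence relation. [folklore]
(private helper, as in g39-#4) -/
private theorem equivalence_conj_subtype {N : ℕ} (P : _root_.Matrix (Fin N) (Fin N) ℤ → Prop) :
    Equivalence (fun B B' : {B : _root_.Matrix (Fin N) (Fin N) ℤ // P B} =>
      ∃ Q : _root_.Matrix (Fin N) (Fin N) ℤ, IsUnit Q.det ∧ Q * B.1 = B'.1 * Q) := by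
  refine ⟨fun B => ⟨1, by rw [Matrix.det_one]; exact isUnit_one, by rw [one_mul, mul_one]⟩, ?_, ?_⟩
  · rintro B B' ⟨Q, hQ, h⟩
    obtain ⟨u, rfl⟩ := (Matrix.isUnit_iff_isUnit_det Q).mpr hQ
    refine ⟨((u⁻¹ : (_root_.Matrix (Fin N) (Fin N) ℤ)ˣ) : _root_.Matrix (Fin N) (Fin N) ℤ),
      (Matrix.isUnit_iff_isUnit_det _).mp (Units.isUnit _), ?_⟩
    calc ((u⁻¹ : (_root_.Matrix (Fin N) (Fin N) ℤ)ˣ) : _root_.Matrix (Fin N) (Fin N) ℤ) * B'.1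
        = ↑u⁻¹ * B'.1 * (↑u * ↑u⁻¹) := by rw [Units.mul_inv, mul_one]
      _ = ↑u⁻¹ * (B'.1 * ↑u) * ↑u⁻¹ := by simp only [mul_assoc]
      _ = ↑u⁻¹ * (↑u * B.1) * ↑u⁻¹ := by rw [h]
      _ = ↑u⁻¹ * ↑u * B.1 * ↑u⁻¹ := by simp only [mul_assoc]
      _ = B.1 * ↑u⁻¹ := by rw [Units.inv_mul, one_mul]
  · rintro B B' B'' ⟨Q, hQ, h⟩ ⟨Q', hQ', h'⟩
    refine ⟨Q' * Q, ?_, ?_⟩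
    · rw [Matrix.det_mul]; exact hQ'.mul hQ
    · rw [mul_assoc, h, ← mul_assoc, h', mul_assoc]

/-- `x² − x − m` is irreducible over `ℚ` when its discriminant `1 + 4m` is negative. [folklore] (private) -/
private theorem irreducible_X_sq_sub_X_sub_C (m : ℤ) (hm : 1 + 4 * m < 0) :
    Irreducible (X ^ 2 - X - C (m : ℚ) : ℚ[X]) := by
  have hmonic : (X ^ 2 - X - C (m : ℚ) : ℚ[X]).Monic := by
    rw [sub_sub]
    exact (monic_X_pow 2).sub_of_left (by
      refine (degree_add_le _ _).trans_lt ?_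
      rw [degree_X_pow, max_lt_iff, degree_X]
      exact ⟨by norm_num, (degree_C_le).trans_lt (by norm_num)⟩)
  have hdeg : (X ^ 2 - X - C (m : ℚ) : ℚ[X]).natDegree = 2 := by
    rw [sub_sub, natDegree_sub_eq_left_of_natDegree_lt, natDegree_X_pow]
    refine (natDegree_add_le _ _).trans_lt ?_
    rw [natDegree_X, natDegree_C, natDegree_X_pow]
    norm_num
  refine (hmonic.irreducible_iff_roots_eq_zero_of_degree_le_three (by rw [hdeg]) (by rw [hdeg]; norm_num)).mpr ?_
  refine Multiset.eq_zero_of_forall_notMem fun b hb => ?_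
  rw [mem_roots hmonic.ne_zero, IsRoot.def, eval_sub, eval_sub, eval_pow, eval_X, eval_C] at hb
  have h0 : (0 : ℚ) ≤ (2 * b - 1) ^ 2 := sq_nonneg _
  have h1 : ((1 + 4 * m : ℤ) : ℚ) < 0 := by exact_mod_cast hm
  push_cast at h1
  nlinarith [hb, h0, h1]

/-! ## §1 The count for `B² = B + m·1`, `d_K = 1 + 4m` -/

section OddDiscriminant

variable {K : Type} [Field K] [NumberField K]

/-- **`θ² = 1 + 4m =: d` (`d < 0` squarefree), `K = ℚ(θ)` quadratic: in every size `2(s+1)` the integer matrices `B`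
with `B² = B + m·1`, modulo `GL(ℤ)`-conjugacy, number exactly `h_K`** (`𝒪_K = ℤ[τ]`, `τ = (1 + θ)/2`,
`τ² = τ + m`; Steinitz). [cite: Reiner1957, §1 Lemma 2 and Remark (with `f = x² − x − m`)] [cite: Marcus2018, Ch. 2 Thm. 1] -/
theorem natCard_quot_conj_sq_eq_self_add_smul_one_eq_classNumber (h2 : Module.finrank ℚ K = 2) {m : ℤ} {θ : K}
    (hθ : θ ^ 2 = ((1 + 4 * m : ℤ) : K)) (hm0 : 1 + 4 * m < 0) (hsf : Squarefree (1 + 4 * m)) (s : ℕ) :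
    Nat.card (Quot (fun B B' : {B : _root_.Matrix (Fin (2 * (s + 1))) (Fin (2 * (s + 1))) ℤ //
          B ^ 2 = B + m • (1 : _root_.Matrix (Fin (2 * (s + 1))) (Fin (2 * (s + 1))) ℤ)} =>
        ∃ Q : _root_.Matrix (Fin (2 * (s + 1))) (Fin (2 * (s + 1))) ℤ, IsUnit Q.det ∧ Q * B.1 = B'.1 * Q)) =
      NumberField.classNumber K := by
  have hd : NumberField.discr K = 1 + 4 * m :=
    discr_eq_of_sq_eq_intCast h2 hθ (by omega) hsf (by omega)
  -- the generator `τ = (1 + θ)/2`, `τ² = τ + m`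
  set τ : K := (1 + θ) / 2 with hτdef
  have hθ' : θ ^ 2 = 1 + 4 * (m : K) := by rw [hθ]; push_cast; ring
  have hτ : τ ^ 2 = ((1 : ℤ) : K) * τ + (m : K) := by
    rw [hτdef]; push_cast; linear_combination (1 / 4 : K) * hθ'
  have hmax := forall_isIntegral_mem_adjoin_of_sq_eq h2 (ε := 1) (m := m) (Or.inr rfl) hτ (by rw [hd])
  have hg : (X ^ 2 - X - C m : ℤ[X]).Monic := by
    rw [sub_sub]
    exact (monic_X_pow 2).sub_of_left (by
      refine (degree_add_le _ _).trans_lt ?_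
      rw [degree_X_pow, max_lt_iff, degree_X]
      exact ⟨by norm_num, (degree_C_le).trans_lt (by norm_num)⟩)
  have hirr : Irreducible ((X ^ 2 - X - C m : ℤ[X]).map (Int.castRingHom ℚ)) := by
    rw [Polynomial.map_sub, Polynomial.map_sub, Polynomial.map_pow, map_X, map_C, eq_intCast]
    exact irreducible_X_sq_sub_X_sub_C m hm0
  have hgτ : aeval τ (X ^ 2 - X - C m : ℤ[X]) = 0 := by
    rw [map_sub, map_sub, map_pow, aeval_X, aeval_C, algebraMap_int_eq, eq_intCast, hτ]
    push_cast; ring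
  have hN : (s + 1) * Module.finrank ℚ K = 2 * (s + 1) := by rw [h2, mul_comm]
  rw [show NumberField.classNumber K = Fintype.card (ClassGroup (𝓞 K)) from rfl,
    ← natCard_quot_conj_aeval_eq_zero_eq_card_classGroup hmax hg hirr hgτ s hN]
  set rS := (fun B B' : {B : _root_.Matrix (Fin (2 * (s + 1))) (Fin (2 * (s + 1))) ℤ //
      aeval B (X ^ 2 - X - C m : ℤ[X]) = 0} =>
    ∃ Q : _root_.Matrix (Fin (2 * (s + 1))) (Fin (2 * (s + 1))) ℤ, IsUnit Q.det ∧ Q * B.1 = B'.1 * Q) with hrS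
  let e : {B : _root_.Matrix (Fin (2 * (s + 1))) (Fin (2 * (s + 1))) ℤ //
        B ^ 2 = B + m • (1 : _root_.Matrix (Fin (2 * (s + 1))) (Fin (2 * (s + 1))) ℤ)} ≃
      {B : _root_.Matrix (Fin (2 * (s + 1))) (Fin (2 * (s + 1))) ℤ // aeval B (X ^ 2 - X - C m : ℤ[X]) = 0} :=
    Equiv.subtypeEquivRight fun B => by
      rw [map_sub, map_sub, map_pow, aeval_X, aeval_C, Algebra.algebraMap_eq_smul_one, sub_sub, sub_eq_zero]
  exact Nat.card_congr (Quot.congr (rb := rS) e fun B B' => Iff.rfl)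

end OddDiscriminant

/-! ## §2 Instances: `d = −7, −15, −23, −163` -/

section Instances

/-- A quadratic field `ℚ(√d)`, `d < 0`: `ℚ[x]/(x² − d)` (Mathlib's `AdjoinRoot`). [folklore] (private, as in g39-#9) -/
private theorem exists_numberField_sq_eq (d : ℤ) (hd : d < 0) :
    ∃ (K : Type) (_ : Field K) (_ : NumberField K), Module.finrank ℚ K = 2 ∧ ∃ θ : K, θ ^ 2 = (d : K) := by
  have hirr : Irreducible (X ^ 2 - C (d : ℚ) : ℚ[X]) := by
    refine X_pow_sub_C_irreducible_of_prime Nat.prime_two fun b hb => ?_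
    have h0 : (0 : ℚ) ≤ b ^ 2 := sq_nonneg b
    rw [hb] at h0
    have h1 : (d : ℚ) < 0 := by exact_mod_cast hd
    linarith
  haveI : Fact (Irreducible (X ^ 2 - C (d : ℚ) : ℚ[X])) := ⟨hirr⟩
  have hmonic : (X ^ 2 - C (d : ℚ) : ℚ[X]).Monic := monic_X_pow_sub_C _ two_ne_zero
  haveI : Module.Finite ℚ (AdjoinRoot (X ^ 2 - C (d : ℚ) : ℚ[X])) := hmonic.finite_adjoinRoot
  haveI : CharZero (AdjoinRoot (X ^ 2 - C (d : ℚ) : ℚ[X])) :=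
    charZero_of_injective_algebraMap (algebraMap ℚ (AdjoinRoot (X ^ 2 - C (d : ℚ) : ℚ[X]))).injective
  haveI : NumberField (AdjoinRoot (X ^ 2 - C (d : ℚ) : ℚ[X])) := NumberField.mk
  refine ⟨AdjoinRoot (X ^ 2 - C (d : ℚ) : ℚ[X]), inferInstance, inferInstance, ?_, AdjoinRoot.root _, ?_⟩
  · rw [(AdjoinRoot.powerBasis hmonic.ne_zero).finrank, AdjoinRoot.powerBasis_dim, natDegree_X_pow_sub_C]
  · have h := AdjoinRoot.eval₂_root (X ^ 2 - C (d : ℚ) : ℚ[X])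
    rw [eval₂_sub, eval₂_X_pow, eval₂_C, sub_eq_zero] at h
    exact h.trans (map_intCast _ d)

/-- The count for `B² = B + m·1` at a kernel value of `h(1 + 4m)`. [cite: Cox2013, §2.A Thm. 2.13 and §7.B Thm. 7.7 (ii)] (private) -/
private theorem natCard_quot_conj_of_classNumber (m : ℤ) (hm0 : 1 + 4 * m < 0) (hsf : Squarefree (1 + 4 * m))
    {h : ℕ} (hh : BinQF.classNumber (1 + 4 * m) = h) (s : ℕ) :
    Nat.card (Quot (fun B B' : {B : _root_.Matrix (Fin (2 * (s + 1))) (Fin (2 * (s + 1))) ℤ //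
          B ^ 2 = B + m • (1 : _root_.Matrix (Fin (2 * (s + 1))) (Fin (2 * (s + 1))) ℤ)} =>
        ∃ Q : _root_.Matrix (Fin (2 * (s + 1))) (Fin (2 * (s + 1))) ℤ, IsUnit Q.det ∧ Q * B.1 = B'.1 * Q)) = h := by
  obtain ⟨K, _, _, h2, θ, hθ⟩ := exists_numberField_sq_eq (1 + 4 * m) hm0
  have hd : NumberField.discr K = 1 + 4 * m := discr_eq_of_sq_eq_intCast h2 hθ (by omega) hsf (by omega)
  rw [natCard_quot_conj_sq_eq_self_add_smul_one_eq_classNumber h2 hθ hm0 hsf s]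
  exact classNumber_eq_of_discr_eq h2 hd (by omega) hh

/-- **ALL INTEGER MATRICES WITH `B² = B − 2·1` (of the same size `2(s+1)`) ARE UNIMODULARLY SIMILAR** — one class
(`𝒪_{ℚ(√−7)} = ℤ[(1 + √−7)/2]`, `h(−7) = 1`). [cite: Reiner1957, §1 Lemma 2 and Remark (with `f = x² − x + 2`)] [cite: Marcus2018, Ch. 2 Thm. 1] [cite: Cox2013, §2.A Thm. 2.13 (`h(−7) = 1`)] -/
theorem natCard_quot_conj_sq_eq_self_sub_two (s : ℕ) :
    Nat.card (Quot (fun B B' : {B : _root_.Matrix (Fin (2 * (s + 1))) (Fin (2 * (s + 1))) ℤ //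
          B ^ 2 = B + (-2 : ℤ) • (1 : _root_.Matrix (Fin (2 * (s + 1))) (Fin (2 * (s + 1))) ℤ)} =>
        ∃ Q : _root_.Matrix (Fin (2 * (s + 1))) (Fin (2 * (s + 1))) ℤ, IsUnit Q.det ∧ Q * B.1 = B'.1 * Q)) = 1 :=
  natCard_quot_conj_of_classNumber (-2) (by norm_num)
    (by rw [← Int.squarefree_natAbs]; exact (Nat.prime_iff.mp (by norm_num)).squarefree) (by decide +kernel) s

/-- … hence any two integer matrices of size `2(s+1)` with `B² = B − 2·1` are `GL(ℤ)`-conjugate.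
[cite: Reiner1957, §1 Lemma 2 and Remark (with `f = x² − x + 2`)] [cite: Cox2013, §2.A Thm. 2.13 (`h(−7) = 1`)] -/
theorem exists_isUnit_conj_of_sq_eq_self_sub_two (s : ℕ)
    (B B' : _root_.Matrix (Fin (2 * (s + 1))) (Fin (2 * (s + 1))) ℤ)
    (hB : B ^ 2 = B + (-2 : ℤ) • (1 : _root_.Matrix (Fin (2 * (s + 1))) (Fin (2 * (s + 1))) ℤ))
    (hB' : B' ^ 2 = B' + (-2 : ℤ) • (1 : _root_.Matrix (Fin (2 * (s + 1))) (Fin (2 * (s + 1))) ℤ)) :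
    ∃ Q : _root_.Matrix (Fin (2 * (s + 1))) (Fin (2 * (s + 1))) ℤ, IsUnit Q.det ∧ Q * B = B' * Q :=
  rel_of_natCard_quot_eq_one (equivalence_conj_subtype _) (natCard_quot_conj_sq_eq_self_sub_two s) ⟨B, hB⟩ ⟨B', hB'⟩

/-- **The integer matrices with `B² = B − 4·1` of size `2(s+1)` form exactly TWO `GL(ℤ)`-classes** (`d = −15`,
`h(−15) = 2`). [cite: Reiner1957, §1 Lemma 2 and Remark (with `f = x² − x + 4`)] [cite: Marcus2018, Ch. 2 Thm. 1] [cite: Cox2013, §2.A Thm. 2.13 (`h(−15) = 2`)] -/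
theorem natCard_quot_conj_sq_eq_self_sub_four (s : ℕ) :
    Nat.card (Quot (fun B B' : {B : _root_.Matrix (Fin (2 * (s + 1))) (Fin (2 * (s + 1))) ℤ //
          B ^ 2 = B + (-4 : ℤ) • (1 : _root_.Matrix (Fin (2 * (s + 1))) (Fin (2 * (s + 1))) ℤ)} =>
        ∃ Q : _root_.Matrix (Fin (2 * (s + 1))) (Fin (2 * (s + 1))) ℤ, IsUnit Q.det ∧ Q * B.1 = B'.1 * Q)) = 2 :=
  natCard_quot_conj_of_classNumber (-4) (by norm_num)
    (by rw [← Int.squarefree_natAbs, show (1 + 4 * (-4) : ℤ).natAbs = 3 * 5 from rfl, Nat.squarefree_mul (by norm_num)]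
        exact ⟨Nat.prime_three.prime.squarefree, Nat.prime_five.prime.squarefree⟩) (by decide +kernel) s

/-- **THE INTEGER MATRICES WITH `B² = B − 6·1` OF SIZE `2(s+1)` FORM EXACTLY THREE CLASSES UNDER `GL(ℤ)`** (`d = −23`,
`𝒪 = ℤ[(1 + √−23)/2]`, `h(−23) = 3`; compare g39-#5/#8, where for `Φ_{23}` only `≥ 3` classes are in the tree).
[cite: Reiner1957, §1 Lemma 2 and Remark (with `f = x² − x + 6`)] [cite: Marcus2018, Ch. 2 Thm. 1] [cite: Cox2013, §2.A Thm. 2.13 (`h(−23) = 3`)] -/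
theorem natCard_quot_conj_sq_eq_self_sub_six (s : ℕ) :
    Nat.card (Quot (fun B B' : {B : _root_.Matrix (Fin (2 * (s + 1))) (Fin (2 * (s + 1))) ℤ //
          B ^ 2 = B + (-6 : ℤ) • (1 : _root_.Matrix (Fin (2 * (s + 1))) (Fin (2 * (s + 1))) ℤ)} =>
        ∃ Q : _root_.Matrix (Fin (2 * (s + 1))) (Fin (2 * (s + 1))) ℤ, IsUnit Q.det ∧ Q * B.1 = B'.1 * Q)) = 3 :=
  natCard_quot_conj_of_classNumber (-6) (by norm_num)
    (by rw [← Int.squarefree_natAbs]; exact (Nat.prime_iff.mp (by norm_num)).squarefree)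
    (by rw [show (1 + 4 * (-6) : ℤ) = -23 by norm_num]; exact classNumber_neg23) s

/-- **… so there are three integer matrices of size `2(s+1)` with `B² = B − 6·1`, pairwise NOT `GL(ℤ)`-conjugate,
to one of which every such matrix is conjugate** (`𝔬^s ⊕ 𝔞`, `[𝔞] ∈ Cl(ℤ[(1+√−23)/2]) ≅ ℤ/3`).
[cite: Reiner1957, §1 Lemma 2 and Remark (with `f = x² − x + 6`)] [cite: Cox2013, §2.A Thm. 2.13 (`h(−23) = 3`)] -/
theorem exists_triple_sq_eq_self_sub_six (s : ℕ) :
    ∃ B : Fin 3 → _root_.Matrix (Fin (2 * (s + 1))) (Fin (2 * (s + 1))) ℤ,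
      (∀ i, B i ^ 2 = B i + (-6 : ℤ) • (1 : _root_.Matrix (Fin (2 * (s + 1))) (Fin (2 * (s + 1))) ℤ)) ∧
      (Pairwise fun i j => ¬ ∃ Q : _root_.Matrix (Fin (2 * (s + 1))) (Fin (2 * (s + 1))) ℤ,
        IsUnit Q.det ∧ Q * B i = B j * Q) ∧
      ∀ C : _root_.Matrix (Fin (2 * (s + 1))) (Fin (2 * (s + 1))) ℤ,
        C ^ 2 = C + (-6 : ℤ) • (1 : _root_.Matrix (Fin (2 * (s + 1))) (Fin (2 * (s + 1))) ℤ) →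
        ∃ i, ∃ Q : _root_.Matrix (Fin (2 * (s + 1))) (Fin (2 * (s + 1))) ℤ, IsUnit Q.det ∧ Q * C = B i * Q := by
  obtain ⟨f, hf, hall⟩ := exists_fun_of_natCard_quot_eq (equivalence_conj_subtype _) (by norm_num)
    (natCard_quot_conj_sq_eq_self_sub_six s)
  exact ⟨fun i => (f i).1, fun i => (f i).2, fun i j hij => hf hij, fun C hC => hall ⟨C, hC⟩⟩

/-- **ALL INTEGER MATRICES WITH `B² = B − 41·1` (of size `2(s+1)`) ARE UNIMODULARLY SIMILAR** — `d = −163`, the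
largest Heegner discriminant: `h(−163) = 1`. [cite: Reiner1957, §1 Lemma 2 and Remark (with `f = x² − x + 41`)] [cite: Marcus2018, Ch. 2 Thm. 1] [cite: Cox2013, Thm. 7.30 (i) (`h(d_K) = 1 ⟺ d_K = −3, −4, −7, −8, −11, −19, −43, −67, −163`)] -/
theorem natCard_quot_conj_sq_eq_self_sub_fortyOne (s : ℕ) :
    Nat.card (Quot (fun B B' : {B : _root_.Matrix (Fin (2 * (s + 1))) (Fin (2 * (s + 1))) ℤ //
          B ^ 2 = B + (-41 : ℤ) • (1 : _root_.Matrix (Fin (2 * (s + 1))) (Fin (2 * (s + 1))) ℤ)} =>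
        ∃ Q : _root_.Matrix (Fin (2 * (s + 1))) (Fin (2 * (s + 1))) ℤ, IsUnit Q.det ∧ Q * B.1 = B'.1 * Q)) = 1 :=
  natCard_quot_conj_of_classNumber (-41) (by norm_num)
    (by rw [← Int.squarefree_natAbs]; exact (Nat.prime_iff.mp (by norm_num)).squarefree) (by decide +kernel) s

/-- … hence any two integer matrices of size `2(s+1)` with `B² = B − 41·1` are `GL(ℤ)`-conjugate.
[cite: Reiner1957, §1 Lemma 2 and Remark (with `f = x² − x + 41`)] [cite: Cox2013, Thm. 7.30 (i) (`h(−163) = 1`)] -/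
theorem exists_isUnit_conj_of_sq_eq_self_sub_fortyOne (s : ℕ)
    (B B' : _root_.Matrix (Fin (2 * (s + 1))) (Fin (2 * (s + 1))) ℤ)
    (hB : B ^ 2 = B + (-41 : ℤ) • (1 : _root_.Matrix (Fin (2 * (s + 1))) (Fin (2 * (s + 1))) ℤ))
    (hB' : B' ^ 2 = B' + (-41 : ℤ) • (1 : _root_.Matrix (Fin (2 * (s + 1))) (Fin (2 * (s + 1))) ℤ)) :
    ∃ Q : _root_.Matrix (Fin (2 * (s + 1))) (Fin (2 * (s + 1))) ℤ, IsUnit Q.det ∧ Q * B = B' * Q :=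
  rel_of_natCard_quot_eq_one (equivalence_conj_subtype _) (natCard_quot_conj_sq_eq_self_sub_fortyOne s)
    ⟨B, hB⟩ ⟨B', hB'⟩

end Instances

end Literature.LinearAlgebra.Matrix.QuadraticIntegerMatrixClassesOddDiscriminant
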